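import Summits.MatrixMultiplication.OmegaCensus.STPPSmallPatternKernelReflect122P

/-!
# ω-census, small STPP pattern `(1,2,2)^k`: SECOND-LEVEL chunking of the kernel search (engine + reflection)

HONEST FRAMING (pub-omega census; verbatim): lottery ticket; floor = certified bounds/negative ranges.
Census STRUCTURE bookkeeping of the STPP track (seat pub-omega-stpp-3, gen 24; STRUCTURE row B5, column `T2`), not progress on `ω`.

`STPP122Neg.search2x` splits a representative's subtree over the first-level codes `c'₀`; some single starts `(y, c'₀)` are still
too long for one kernel evaluation (e.g. `ℤ/2 × ℤ/14`, `k = 4`, both `B₀`- and `C₀`-differences involutions: ≈ 375 s).  This file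
adds a search whose start `(y, c'₀)` is FIXED and whose SECOND level is chunked by an exclusion mask on the code of `b₁`
(`level2m`, `start2xx`, `search2xx`), proves that it refutes a normal-form solution whose `b₁`-code is allowed
(`start2xx_false`), and gives the combined reflection theorem `not_exists_isSTPP_122_of_search2xx_dualP`: first-level chunks
(`search2x`) and second-level chunks (`search2xx`) together, with the covering / stabiliser / duality reductions of
`STPPSmallPatternKernelReflect122{S,D,P}.lean`.

References: H. Cohn, R. Kleinberg, B. Szegedy, C. Umans, FOCS 2005 (arXiv:math/0511460), Def. 5.1.
-/

namespace Summit.MatrixMultiplication.OmegaCensus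

namespace STPP122Neg

open STPP211Neg Literature.Computability.AlgebraicComplexity

/-! ## Engine: one level with a mask on the `b`-code, fixed start, chunk list -/

/-- One level below the state `S` with the free-`b` codes additionally restricted to the complement of the mask `xb`
(children searched by `k`); otherwise identical to `level2`. -/
noncomputable def level2m (g : GC) (S : St2) (xb : ℕ) (k : St2 → Bool) : Bool :=
  force (Nat.xor g.full (Nat.lor (Nat.lor S.BS S.PB) (Nat.land (lowMask (Nat.add S.lastB 1)) g.full))) fun freeB =>
  force (Nat.land freeB (Nat.xor g.full xb)) fun freeBm =>
  allBits freeBm (fun b =>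
    force (g.tr S.NIM b) fun NIMb =>
    force (Nat.xor g.full (Nat.lor (Nat.xor g.full freeB) (Nat.land (lowMask (Nat.add b 1)) g.full))) fun freeB' =>
    allBits freeB' (fun b' =>
      force (Nat.xor g.full (Nat.lor (Nat.lor (Nat.lor S.CS S.PC) NIMb) (g.tr S.NIM b'))) fun freeC =>
      allBits freeC (fun c =>
        force (Nat.xor g.full (Nat.lor (Nat.xor g.full freeC) (Nat.land (lowMask (Nat.add c 1)) g.full))) fun freeC' =>
        allBits freeC' (fun c' => !(validNew g S b b' c c') || child2 g S b b' c c' k) freeC')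
        freeC)
      freeB')
    freeBm

/-- THE FIXED START `(y, c'₀)` (`B₀ = {0, y}`, `C₀ = {0, c'₀}`) whose next level excludes the `b₁`-codes set in `xb`, continued by
`below2 g r` (`r` = number of triples left after the first two). -/
noncomputable def start2xx (g : GC) (y c1 xb r : ℕ) : Bool :=
  !(validNew g St2.empty 0 y 0 c1) || child2 g St2.empty 0 y 0 c1 (fun S => level2m g S xb (below2 g r))

/-- THE SECOND-LEVEL-CHUNKED SEARCH over triples `(y, c'₀, xb)`: `true` certifies that no normal-form solution with `B₀ = {0, y}`,
`C₀ = {0, c'₀}` and the code of `b₁` outside `xb` exists (`k ≥ 2` triples). -/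
noncomputable def search2xx (g : GC) (k : ℕ) (chunks : List (ℕ × ℕ × ℕ)) : Bool :=
  @List.rec (ℕ × ℕ × ℕ) (fun _ => Bool) true (fun e _ ih => start2xx g e.1 e.2.1 e.2.2 (Nat.sub k 2) && ih) chunks

/-- `search2xx` on a cons. -/
theorem search2xx_cons (g : GC) (k : ℕ) (e : ℕ × ℕ × ℕ) (R : List (ℕ × ℕ × ℕ)) :
    search2xx g k (e :: R) = (start2xx g e.1 e.2.1 e.2.2 (k - 2) && search2xx g k R) := rfl

/-- `search2xx` is a conjunction over the chunk list. -/
theorem search2xx_append (g : GC) (k : ℕ) (R₁ R₂ : List (ℕ × ℕ × ℕ)) :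
    search2xx g k (R₁ ++ R₂) = (search2xx g k R₁ && search2xx g k R₂) := by
  induction R₁ with
  | nil => rfl
  | cons e R ih => rw [List.cons_append, search2xx_cons, search2xx_cons, ih, Bool.and_assoc]

/-- A `true` second-level-chunked search refutes every listed chunk. -/
theorem start2xx_of_search2xx {g : GC} {k : ℕ} : ∀ {R : List (ℕ × ℕ × ℕ)}, search2xx g k R = true → ∀ e ∈ R,
    start2xx g e.1 e.2.1 e.2.2 (k - 2) = true := by
  intro R
  induction R with
  | nil => intro _ e he; simp at he
  | cons e' R ih =>
      intro h e he
      rw [search2xx_cons, Bool.and_eq_true] at h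
      rcases List.mem_cons.1 he with rfl | he
      · exact h.1
      · exact ih h.2 e he

/-! ## Reflection -/

section Refl

variable {G : Type} [AddCommGroup G] {E : GEnc G} {K : ℕ} {b b' c c' : Fin K → G}

/-- The masked free-`b` mask of `level2m`. -/
def fBm (g : GC) (S : St2) (xb : ℕ) : ℕ := Nat.land (fB g S) (Nat.xor g.full xb)

/-- `level2m` unfolded. -/
theorem level2m_eq (g : GC) (S : St2) (xb : ℕ) (k : St2 → Bool) :
    level2m g S xb k = allBits (fBm g S xb) (fun b => allBits (fB2 g S b) (fun b' => allBits (fC g S b b') (fun c =>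
      allBits (fC2 g S b b' c) (fun c' => !(validNew g S b b' c c') || child2 g S b b' c c' k) (fC2 g S b b' c))
      (fC g S b b')) (fB2 g S b)) (fBm g S xb) := by
  unfold level2m fBm fB fB2 fC fC2; simp only [force_eq]; rfl

/-- ONE MASKED LEVEL OF THE SOLUTION'S BRANCH IS NOT REFUTED when the code of `b_m` is outside the mask. -/
theorem level2m_false (hM : ModelD2 b b' c c') (hNF : NF2 E b b' c c') {m : ℕ} (im : Fin K) (him : im.val = m)
    (ip : Fin K) (hip : ip.val + 1 = m) {S : St2} (hS : InvM2 E b b' c c' m S) (hlast : S.lastB = E.enc (b ip))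
    {xb : ℕ} (hxb : xb.testBit (E.enc (b im)) = false)
    {k : St2 → Bool} (hk : ∀ S', InvM2 E b b' c c' (m + 1) S' → S'.lastB = E.enc (b im) → k S' = false) :
    level2m E.g S xb k = false := by
  rw [level2m_eq]
  have hBfree : ∀ {t : G}, InA b b' im t → (fB E.g S).testBit (E.enc t) = true := by
    intro t ht
    unfold fB
    rw [testBit_fullXor, lor_eq, lor_eq, Nat.testBit_lor, Nat.testBit_lor, hS.bs_free hM im him ht, hS.pb_free hM im him ht,
      testBit_lowMask_land, add_eq', hlast]
    have h1 := hNF.1 ip im (by rw [Fin.lt_def]; omega)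
    have h2 : E.enc (b im) ≤ E.enc t := by
      rcases ht with rfl | rfl
      · exact le_rfl
      · exact le_of_lt (hNF.2.1 im)
    simp; omega
  have hb : (fBm E.g S xb).testBit (E.enc (b im)) = true := by
    unfold fBm
    rw [land_eq, Nat.testBit_land, hBfree (inA_p im), testBit_fullXor, hxb]; rfl
  have hb' : (fB2 E.g S (E.enc (b im))).testBit (E.enc (b' im)) = true := by
    unfold fB2
    rw [testBit_fullXor, lor_eq, Nat.testBit_lor, testBit_fullXor, hBfree (inA_q im), testBit_lowMask_land, add_eq']
    have := hNF.2.1 im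
    simp; omega
  have hCfree : ∀ {u : G}, InA c c' im u → (fC E.g S (E.enc (b im)) (E.enc (b' im))).testBit (E.enc u) = true := by
    intro u hu
    unfold fC
    rw [testBit_fullXor, lor_eq, lor_eq, lor_eq, Nat.testBit_lor, Nat.testBit_lor, Nat.testBit_lor,
      hS.cs_free hM im him hu, hS.pc_free hM im him hu, hS.nim_free hM im him (inA_p im) hu,
      hS.nim_free hM im him (inA_q im) hu]; rfl
  have hc : (fC E.g S (E.enc (b im)) (E.enc (b' im))).testBit (E.enc (c im)) = true := hCfree (inA_p im)
  have hc' : (fC2 E.g S (E.enc (b im)) (E.enc (b' im)) (E.enc (c im))).testBit (E.enc (c' im)) = true := by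
    unfold fC2
    rw [testBit_fullXor, lor_eq, Nat.testBit_lor, testBit_fullXor, hCfree (inA_q im), testBit_lowMask_land, add_eq']
    have := hNF.2.2 im
    simp; omega
  cases h : allBits (fBm E.g S xb) _ (fBm E.g S xb)
  · rfl
  exfalso
  have h1 := allBits_spec _ _ _ le_rfl h _ hb
  have h2 := allBits_spec _ _ _ le_rfl h1 _ hb'
  have h3 := allBits_spec _ _ _ le_rfl h2 _ hc
  have h4 := allBits_spec _ _ _ le_rfl h3 _ hc'
  rw [validNew_true hM hS im him, child2_eq, hk _ (invM2_childSt2 im him hS) rfl] at h4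
  exact Bool.false_ne_true h4

/-- THE FIXED START OF THE SOLUTION ANSWERS `false` when the mask misses the code of `b₁` (`K ≥ 2`). -/
theorem start2xx_false (hM : ModelD2 b b' c c') (hNF : NF2 E b b' c c') (hK : 2 ≤ K) (hb0 : b ⟨0, by omega⟩ = 0)
    (hc0 : c ⟨0, by omega⟩ = 0) {xb : ℕ} (hxb : xb.testBit (E.enc (b ⟨1, hK⟩)) = false) :
    start2xx E.g (E.enc (b' ⟨0, by omega⟩)) (E.enc (c' ⟨0, by omega⟩)) xb (K - 2) = false := by
  set i0 : Fin K := ⟨0, by omega⟩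
  set i1 : Fin K := ⟨1, hK⟩
  unfold start2xx
  have e0 : (0 : ℕ) = E.enc (b i0) := by rw [hb0, E.enc_zero]
  have e0' : (0 : ℕ) = E.enc (c i0) := by rw [hc0, E.enc_zero]
  conv => lhs; rw [show validNew E.g St2.empty 0 (E.enc (b' i0)) 0 (E.enc (c' i0)) =
    validNew E.g St2.empty (E.enc (b i0)) (E.enc (b' i0)) (E.enc (c i0)) (E.enc (c' i0)) by rw [← e0, ← e0'],
    show child2 E.g St2.empty 0 (E.enc (b' i0)) 0 (E.enc (c' i0)) (fun S => level2m E.g S xb (below2 E.g (K - 2))) =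
    child2 E.g St2.empty (E.enc (b i0)) (E.enc (b' i0)) (E.enc (c i0)) (E.enc (c' i0))
      (fun S => level2m E.g S xb (below2 E.g (K - 2))) by rw [← e0, ← e0']]
  rw [validNew_true hM (invM2_empty E b b' c c') i0 rfl, child2_eq]
  have hS1 := invM2_childSt2 (E := E) (b := b) (b' := b') (c := c) (c' := c') i0 rfl (invM2_empty E b b' c c')
  have hlev : level2m E.g (childSt2 E.g St2.empty (E.enc (b i0)) (E.enc (b' i0)) (E.enc (c i0)) (E.enc (c' i0))) xb
      (below2 E.g (K - 2)) = false :=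
    level2m_false hM hNF i1 rfl i0 rfl hS1 rfl hxb fun S' hS' hl' =>
      below2_false hM hNF (K - 2) 2 i1 S' (by omega) rfl hS' hl'
  rw [hlev]; rfl

/-- **REFLECTION THROUGH DEF. 5.1 with first- AND second-level chunks, parametrised maps, stabiliser + duality cover**
(pattern `(1,2,2)^k`, `k ≥ 2`): as `not_exists_isSTPP_122_of_search2x_dualP`, but a start `(y, c'₀)` may be certified EITHER
by a first-level chunk of `search2x` OR by second-level chunks of `search2xx` covering every `b₁`-code.
[cite: CohnKleinbergSzegedyUmans2005, Def. 5.1] -/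
theorem not_exists_isSTPP_122_of_search2xx_dualP [DecidableEq G] (E : GEnc G) (hK : 2 ≤ K) {chunks : List (ℕ × ℕ)}
    (hsearch : search2x E.g K chunks = true) {chunks3 : List (ℕ × ℕ × ℕ)} (hsearch3 : search2xx E.g K chunks3 = true)
    {reps : List ℕ} {ι κ : Type*} (mkA : ι → G → G) (IA : List ι)
    (haddA : ∀ i ∈ IA, ∀ a b : G, mkA i (a + b) = mkA i a + mkA i b) (hkerA : ∀ i ∈ IA, ∀ x : G, mkA i x = 0 → x = 0)
    (hcover : ∀ d : G, d ≠ 0 → ∃ i ∈ IA, E.enc (mkA i d) ∈ reps)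
    (mkS : κ → G → G) (IS : List κ)
    (haddS : ∀ j ∈ IS, ∀ a b : G, mkS j (a + b) = mkS j a + mkS j b) (hkerS : ∀ j ∈ IS, ∀ x : G, mkS j x = 0 → x = 0)
    (hchunks : ∀ d : G, E.enc d ∈ reps → ∀ z : G,
      (∃ j ∈ IS, mkS j d = d ∧
        ((∃ e ∈ chunks, e.1 = E.enc d ∧ e.2.testBit (E.enc (mkS j z)) = false) ∨
         (∀ v, v < E.g.n → ∃ e ∈ chunks3, e.1 = E.enc d ∧ e.2.1 = E.enc (mkS j z) ∧ e.2.2.testBit v = false))) ∨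
      (∃ i ∈ IA, E.enc (mkA i (-z)) ∈ reps ∧ ∃ j ∈ IS, mkS j (mkA i (-z)) = mkA i (-z) ∧
        ((∃ e ∈ chunks, e.1 = E.enc (mkA i (-z)) ∧ e.2.testBit (E.enc (mkS j (mkA i (-d)))) = false) ∨
         (∀ v, v < E.g.n → ∃ e ∈ chunks3, e.1 = E.enc (mkA i (-z)) ∧ e.2.1 = E.enc (mkS j (mkA i (-d))) ∧
           e.2.2.testBit v = false)))) :
    ¬ ∃ A B C : Fin K → Finset G, IsSTPP A B C ∧ ∀ i, (A i).card = 1 ∧ (B i).card = 2 ∧ (C i).card = 2 := by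
  have hK1 : 0 < K := by omega
  rw [exists_isSTPP_122_iff]
  rintro ⟨p, p', q, q', hb, hc, hU, hX⟩
  have hM : ModelD2 p p' q q' := modelD2_of_finsetForm hb hc hU hX
  have haddLA : ∀ f ∈ IA.map mkA, ∀ a b : G, f (a + b) = f a + f b := fun f hf => by
    obtain ⟨i, hi, rfl⟩ := List.mem_map.1 hf; exact haddA i hi
  have haddLS : ∀ f ∈ IS.map mkS, ∀ a b : G, f (a + b) = f a + f b := fun f hf => by
    obtain ⟨j, hj, rfl⟩ := List.mem_map.1 hf; exact haddS j hj
  set LA : List (G →+ G) := (IA.map mkA).attach.map fun x => AddMonoidHom.mk' x.1 (haddLA x.1 x.2)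
  set LS : List (G →+ G) := (IS.map mkS).attach.map fun x => AddMonoidHom.mk' x.1 (haddLS x.1 x.2)
  have memLA : ∀ i ∈ IA, ∃ φ ∈ LA, ⇑φ = mkA i := fun i hi =>
    exists_mem_attach_map haddLA (List.mem_map.2 ⟨i, hi, rfl⟩)
  have memLS : ∀ j ∈ IS, ∃ φ ∈ LS, ⇑φ = mkS j := fun j hj =>
    exists_mem_attach_map haddLS (List.mem_map.2 ⟨j, hj, rfl⟩)
  have hinjA : ∀ φ ∈ LA, Function.Injective φ := fun φ hφ => by
    obtain ⟨f, hf, hφf⟩ := coe_mem_of_mem_attach_map hφ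
    obtain ⟨i, hi, rfl⟩ := List.mem_map.1 hf
    rw [hφf]; exact injective_of_additive_of_ker (haddA i hi) (hkerA i hi)
  have hinjS : ∀ φ ∈ LS, Function.Injective φ := fun φ hφ => by
    obtain ⟨f, hf, hφf⟩ := coe_mem_of_mem_attach_map hφ
    obtain ⟨j, hj, rfl⟩ := List.mem_map.1 hf
    rw [hφf]; exact injective_of_additive_of_ker (haddS j hj) (hkerS j hj)
  have hcoverA : ∀ d : G, d ≠ 0 → ∃ φ ∈ LA, E.enc (φ d) ∈ reps := fun d hd => by
    obtain ⟨i, hi, h⟩ := hcover d hd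
    obtain ⟨φ, hφ, hφf⟩ := memLA i hi
    exact ⟨φ, hφ, by rw [hφf]; exact h⟩
  -- the `good` predicate: first-level chunk or full second-level cover
  obtain ⟨r, r', s, s', hMr, hNF, hr0, hs0, -, hgood⟩ := exists_normalForm2_dual E hM hK1 hinjA hcoverA hinjS
    (good := fun y w => (∃ e ∈ chunks, e.1 = y ∧ e.2.testBit w = false) ∨
      (∀ v, v < E.g.n → ∃ e ∈ chunks3, e.1 = y ∧ e.2.1 = w ∧ e.2.2.testBit v = false)) (fun d hd z => by
      rcases hchunks d hd z with ⟨j, hj, hjd, hrest⟩ | ⟨i, hi, hid, j, hj, hjd, hrest⟩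
      · obtain ⟨ψ, hψ, hψg⟩ := memLS j hj
        exact Or.inl ⟨ψ, hψ, by rw [hψg]; exact hjd, by rw [hψg]; exact hrest⟩
      · obtain ⟨φ, hφ, hφf⟩ := memLA i hi
        obtain ⟨ψ, hψ, hψg⟩ := memLS j hj
        refine Or.inr ⟨φ, hφ, by rw [hφf]; exact hid, ψ, hψ, by rw [hψg, hφf]; exact hjd, ?_⟩
        rw [hψg, hφf]; exact hrest)
  rcases hgood with ⟨e, he, h1, h2⟩ | hall
  · have := start2x_of_search2x hsearch e he
    obtain ⟨y, x1⟩ := e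
    simp only at h1 h2
    subst h1
    rw [start2x_false hMr hNF hK1 hr0 hs0 h2] at this
    exact Bool.false_ne_true this
  · obtain ⟨e, he, h1, h2, h3⟩ := hall (E.enc (r ⟨1, hK⟩)) (E.enc_lt _)
    have := start2xx_of_search2xx hsearch3 e he
    obtain ⟨y, z, xb⟩ := e
    simp only at h1 h2 h3
    subst h1; subst h2
    rw [start2xx_false hMr hNF hK hr0 hs0 h3] at this
    exact Bool.false_ne_true this

end Refl

end STPP122Neg

end Summit.MatrixMultiplication.OmegaCensus
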